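import Summits.QuantumFields.YangMills.Theorems.BalabanUVNodesN15KingModelSrcDivReflection
import Summits.QuantumFields.YangMills.Theorems.BalabanUVNodesN15KingModelSrcDivCellOscillation
import HarnessLib

/-!
# BalabanUVNodes ∕ N15 — THE KING-MODEL RUNG, PROGRAMME Y (the dressed SOURCE-DIVERGENCE entry of the King jet), FILE 67:
# THE THREE ROWS OF THE FORWARD SOURCE DIFFERENCE `S̃_μ = A₀⁻¹N∇_μ ⊗ 1` — plain (coarse ∕ fine), two-grid η-defect, cell oscillation — READ OFF the `kingSOp` rows
# BY BLOCK-FACE REFLECTION (FILE 66)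

WHO ∕ WHEN.  Cell `pub-ymgap`, seat `pub-ymgap-dag-n15-d` (R134, N15 NE2 s3 = King-model rung, g22); `--kind proof --supports stmt-QuantumFields-27366 --as helper`
(K3⁸; count-neutral).  THEOREMS ONLY (0 `def`).  Over FILE 66 (★ `reflC_comp_tensorId_kingSOp_comp`, ★★ `hasMaj_reflConj`, `idef_reflConj`, `pull_comp_idef_mulOp`,
`blockAvg_comp_refl`, `blockOf_torRefl`, `kingPrV_reflC`, `tdistT_torRefl`), FILE 65 (★★ `hasMaj_kingSOp_comp_idef_mulOp_blockAvg`), dag-n15-e Σ-a `hasMaj_kingSOp` ∕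
`hasMaj_kingSOp_fine`, dag-n15-a K-A `hasMaj_idef_tensorId_kingSOp` BY NAME; nothing in the tree is modified.

WHY (this seat's ARCHITECTURE NOTE «ENTRY 2 LIVE BY PARTS», pub-ymgap INBOX l.43300).  The by-parts fixed point of the dressed third entry,
`Y = S_κ + [G∘M_{c−Σb} + Σ_μ S̃_μ∘M_{ã_μ}]Y`, consumes for `S̃_μ = A₀⁻¹∘N(s_μ − 1)` exactly the rows III-B ∕ `idef_neumann_majorant_flat` consume for any step operator:
plain block majorants on both grids, the two-grid η-defect with a rate, and the cell-oscillation row against the fitted coarse letter.  `S̃_μ = σ_μ∘kingSOp_μ∘σ_μ`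
(FILE 66), King's pairing, blocks and block averages commute with `σ_μ`, and `σ_μ` is an isometry of the block torus — so each row is the corresponding `kingSOp`
row conjugated.

WHAT.  Writing `S̃(Kl, N)_μ := kingGOp L a m² Kl N M ∘ N•(pull(· + e_μ) − id)` (no `def`; the RHS of FILE 66's ★):
§1 `hasMaj_tensorId_kingSOpFwd_coarse` ∕ `_fine` (plain rows `β·e^{−δd}`); §2 ★ `hasMaj_idef_tensorId_kingSOpFwd` (`𝔇_{kingPrV}(S̃′_μ ⊗ 1, S̃̄_μ ⊗ 1) ≤ m₀(L^K)^{−γ∕2}e^{−δd}`,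
`0 ≤ γ < 1`); §3 ★★ `hasMaj_kingSOpFwd_comp_idef_mulOp_blockAvg` (`(S̃′_μ ⊗ 1)∘𝔇_{kingPrV}(M_{c′}, M_{blockAvg c′}) ≤ C·r·(L^K)^{−1∕(8(d+1))}·e^{−δd}`, NO letter on `∇c′`).

HONEST FRAMING ∕ LIMITS.  King's `A = 0` MODEL on finite tori (template literature [King1986] (2.13)–(2.17) p.653, (4.1)–(4.5) p.670), abelianised scalar multipliers
— NOT Bałaban's covariant `G(U)`; [Balaban1985BackgroundPropagators] (3.42) p.397 ∕ (3.52) p.400 cited as SHAPE only; rate exponents are currency artefacts.  NE2⁺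
NOT PRINTED ∕ NOT proved; no statement of record touched; N15 NOT discharged; K3⁸ OPEN; counts UNMOVED (typed 28∕28 · discharged 5∕27); one finite torus per index —
NOT ℝ⁴ ∕ infinite volume ∕ OS ∕ mass gap ∕ Clay.
-/

noncomputable section

open scoped BigOperators Matrix
open Finset

namespace Summit.QuantumFields.YangMills.BalabanUVNodes.N15.KingModel.SrcDiv

open Literature.MathematicalPhysics.QuantumFieldTheory.Balaban1983to89
open Literature.MathematicalPhysics.QuantumFieldTheory.Balaban1983to89.B11SectG (BlockNorm HasMaj)
open Literature.MathematicalPhysics.QuantumFieldTheory.Balaban1983to89.T4EtaRateDefect (idef idef_apply)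
open Literature.MathematicalPhysics.QuantumFieldTheory.Balaban1983to89.T4EtaRateCoeffDefect (pull pull_apply blockAvg)
open Literature.MathematicalPhysics.QuantumFieldTheory.Balaban1983to89.B6Prop26Gluing (mulOp mulOp_apply)
open Literature.MathematicalPhysics.QuantumFieldTheory.Balaban1983to89.B5Prop11Plancherel (Tor fine unitVec)
open Literature.MathematicalPhysics.QuantumFieldTheory.King1986 (aK)
open Literature.MathematicalPhysics.QuantumFieldTheory.King1986.Torus (fineOp blockOf tdistT tdistT_nonneg)
open Literature.MathematicalPhysics.QuantumFieldTheory.Balaban1983to89.B6UnitTorusCarrier (unitTorusGeo)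
open Summit.QuantumFields.YangMills.BalabanUVNodes.N15.VectorPiece (kingPr kingPrV blkFine tensorId tensorId_apply hasMaj_tensorId)
open Summit.QuantumFields.YangMills.BalabanUVNodes.N15.TwoGrid (torRefl torRefl_torRefl)
open Summit.QuantumFields.YangMills.BalabanUVNodes.N15.TwoGrid.KingJet (blockOf_comp_underPtN hasMaj_idef_tensorId_kingSOp)
open Summit.QuantumFields.YangMills.BalabanUVNodes.N15KingModelRung.Curved (kingGOp kingSOp underPtN hasMaj_kingSOp hasMaj_kingSOp_fine)

variable {d : ℕ} {L : ℕ} [NeZero L]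

/-! ## §1 Plain rows of `S̃_μ ⊗ 1`, coarse and fine -/

/-- **PLAIN ROW, COARSE**: `S̃_μ ⊗ 1 = (A₀⁻¹N∇_μ) ⊗ 1 ≤ β·e^{−δ|y−y′|_T}` between King's coarse blocks (Σ-a `hasMaj_kingSOp` ⊗ 1, conjugated by `σ_μ`, FILE 66).
[cite: Balaban1985BackgroundPropagators, Thm 3.1 (3.42) p.397 (third entry, shape); King1986, Thm 3.3 (3.7) p.656, (4.1)–(4.5) p.670] -/
theorem hasMaj_tensorId_kingSOpFwd_coarse (hLodd : Odd L) (hL : 2 ≤ L) {a : ℝ} (ha : 0 < a) {m0sq : ℝ} (hm0 : 0 ≤ m0sq) :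
    ∃ β δ : ℝ, 0 < β ∧ 0 < δ ∧ ∀ (K : ℕ), 1 ≤ K → ∀ (e : ℕ) (M : Fin (d + 1) → ℕ) [∀ μ, NeZero (M μ)], (∀ μ, M μ = 2 * L ^ e) →
      ∀ (msq : ℝ), 0 < msq → msq ≤ m0sq → ∀ (μ : Fin (d + 1)),
      HasMaj (BlockNorm.ofBlocks (unitTorusGeo L K M) (blkFine L K M)) (BlockNorm.ofBlocks (unitTorusGeo L K M) (blkFine L K M))
        (tensorId (Fin (d + 1)) (kingGOp L a msq K (L ^ K) M ∘ₗ
          (((L ^ K : ℕ) : ℝ) • (pull (fun y : Tor (fine (L ^ K) M) => y + unitVec (fine (L ^ K) M) μ) - LinearMap.id))))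
        (fun y y' => β * Real.exp (-(δ * tdistT M y y'))) := by
  obtain ⟨β, δ, hβ, hδ, H⟩ := hasMaj_kingSOp (d := d) L hLodd hL ha hm0
  refine ⟨β, δ, hβ, hδ, fun K hK e M _ hM msq hmsq hcap μ => ?_⟩
  have h0 := hasMaj_tensorId (Fin (d + 1)) (fun y y' => mul_nonneg hβ.le (Real.exp_nonneg _)) (H K hK e M hM msq hmsq hcap 1 μ)
  have h := hasMaj_reflConj (g := unitTorusGeo L K M) (blk₁ := blkFine L K M) (blk₂ := blkFine L K M)
    (φ₁ := fun p : Tor (fine (L ^ K) M) × Fin (d + 1) => (torRefl (fine (L ^ K) M) μ p.1, p.2))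
    (φ₂ := fun p : Tor (fine (L ^ K) M) × Fin (d + 1) => (torRefl (fine (L ^ K) M) μ p.1, p.2)) (ψ := torRefl M μ)
    (fun y => torRefl_torRefl y) (fun p => blockOf_torRefl (L ^ K) M μ p.1) (fun p => blockOf_torRefl (L ^ K) M μ p.1)
    (fun y y' => mul_nonneg hβ.le (Real.exp_nonneg _)) (fun y y' => by rw [tdistT_torRefl]) h0
  rwa [reflC_comp_tensorId_kingSOp_comp] at h

/-- **PLAIN ROW, FINE**: `S̃′_μ ⊗ 1 ≤ β·e^{−δ|y−y′|_T}` between the fine unit blocks `blockOf (L^nL^K) ∘ fst` (Σ-a `hasMaj_kingSOp_fine` ⊗ 1, conjugated).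
[cite: Balaban1985BackgroundPropagators, Thm 3.1 (3.42) p.397 (third entry, shape); King1986, Thm 3.3 (3.7) p.656, (4.1)–(4.5) p.670] -/
theorem hasMaj_tensorId_kingSOpFwd_fine (hLodd : Odd L) (hL : 2 ≤ L) {a : ℝ} (ha : 0 < a) {m0sq : ℝ} (hm0 : 0 ≤ m0sq) :
    ∃ β δ : ℝ, 0 < β ∧ 0 < δ ∧ ∀ (K : ℕ), 1 ≤ K → ∀ (n e : ℕ) (M : Fin (d + 1) → ℕ) [∀ μ, NeZero (M μ)], (∀ μ, M μ = 2 * L ^ e) →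
      ∀ (msq : ℝ), 0 < msq → msq ≤ m0sq → ∀ (μ : Fin (d + 1)),
      HasMaj (BlockNorm.ofBlocks (unitTorusGeo L K M) (fun i : Tor (fine (L ^ n * L ^ K) M) × Fin (d + 1) => blockOf (L ^ n * L ^ K) M i.1))
        (BlockNorm.ofBlocks (unitTorusGeo L K M) (fun i : Tor (fine (L ^ n * L ^ K) M) × Fin (d + 1) => blockOf (L ^ n * L ^ K) M i.1))
        (tensorId (Fin (d + 1)) (kingGOp L a msq (K + n) (L ^ n * L ^ K) M ∘ₗ
          (((L ^ n * L ^ K : ℕ) : ℝ) • (pull (fun y : Tor (fine (L ^ n * L ^ K) M) => y + unitVec (fine (L ^ n * L ^ K) M) μ) - LinearMap.id))))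
        (fun y y' => β * Real.exp (-(δ * tdistT M y y'))) := by
  obtain ⟨β, δ, hβ, hδ, H⟩ := hasMaj_kingSOp_fine (d := d) L hLodd hL ha hm0
  refine ⟨β, δ, hβ, hδ, fun K hK n e M _ hM msq hmsq hcap μ => ?_⟩
  have h1 := H K hK n e M hM msq hmsq hcap 1 μ
  rw [blockOf_comp_underPtN] at h1
  have h0 := hasMaj_tensorId (Fin (d + 1)) (fun y y' => mul_nonneg hβ.le (Real.exp_nonneg _)) h1
  have h := hasMaj_reflConj (g := unitTorusGeo L K M)
    (blk₁ := fun i : Tor (fine (L ^ n * L ^ K) M) × Fin (d + 1) => blockOf (L ^ n * L ^ K) M i.1)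
    (blk₂ := fun i : Tor (fine (L ^ n * L ^ K) M) × Fin (d + 1) => blockOf (L ^ n * L ^ K) M i.1)
    (φ₁ := fun p : Tor (fine (L ^ n * L ^ K) M) × Fin (d + 1) => (torRefl (fine (L ^ n * L ^ K) M) μ p.1, p.2))
    (φ₂ := fun p : Tor (fine (L ^ n * L ^ K) M) × Fin (d + 1) => (torRefl (fine (L ^ n * L ^ K) M) μ p.1, p.2)) (ψ := torRefl M μ)
    (fun y => torRefl_torRefl y) (fun p => blockOf_torRefl (L ^ n * L ^ K) M μ p.1) (fun p => blockOf_torRefl (L ^ n * L ^ K) M μ p.1)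
    (fun y y' => mul_nonneg hβ.le (Real.exp_nonneg _)) (fun y y' => by rw [tdistT_torRefl]) h0
  rwa [reflC_comp_tensorId_kingSOp_comp] at h

/-! ## §2 ★ The two-grid η-defect of `S̃_μ ⊗ 1` -/

/-- ★ **THE η-DEFECT OF THE FORWARD SOURCE DIFFERENCE**: `𝔇_{kingPrV}(S̃′_μ ⊗ 1, S̃̄_μ ⊗ 1) ≤ m₀·(L^K)^{−γ∕2}·e^{−δ|y−y′|_T}` (`0 ≤ γ < 1`; K-A `hasMaj_idef_tensorId_kingSOp` —
King's (3.71)∕(3.73) for the third entry — conjugated: King's pairing commutes with `σ_μ`, FILE 66 `idef_reflConj` + `hasMaj_reflConj`).  NOT obtainable from the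
`kingSOp` defect by composing with shifts (the fine and the coarse one-step shifts do not intertwine through the pairing). [cite: King1986, Prop. 3.8 (3.71) p.664,
Prop. 3.9 (3.73) p.665, p.664 (pairing); Balaban1985BackgroundPropagators, Thm 3.1 (3.42) p.397 (third entry, shape)] -/
theorem hasMaj_idef_tensorId_kingSOpFwd (hLodd : Odd L) (hL : 2 ≤ L) {a : ℝ} (ha : 0 < a) {m0sq : ℝ} (hm0 : 0 ≤ m0sq) {γ : ℝ} (hγ0 : 0 ≤ γ) (hγ1 : γ < 1) :
    ∃ m₀ δ : ℝ, 0 < m₀ ∧ 0 < δ ∧ ∀ (K : ℕ), 1 ≤ K → ∀ (n : ℕ), 1 ≤ n → ∀ (e : ℕ) (M : Fin (d + 1) → ℕ) [∀ μ, NeZero (M μ)], (∀ μ, M μ = 2 * L ^ e) →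
      ∀ (msq : ℝ), 0 < msq → msq ≤ m0sq → ∀ (μ : Fin (d + 1)),
      HasMaj (BlockNorm.ofBlocks (unitTorusGeo L K M) (blkFine L K M))
        (BlockNorm.ofBlocks (unitTorusGeo L K M) (fun i : Tor (fine (L ^ n * L ^ K) M) × Fin (d + 1) => blockOf (L ^ n * L ^ K) M i.1))
        (idef (pull (kingPrV L K n M)) (pull (kingPrV L K n M))
          (tensorId (Fin (d + 1)) (kingGOp L a msq (K + n) (L ^ n * L ^ K) M ∘ₗ
            (((L ^ n * L ^ K : ℕ) : ℝ) • (pull (fun y : Tor (fine (L ^ n * L ^ K) M) => y + unitVec (fine (L ^ n * L ^ K) M) μ) - LinearMap.id))))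
          (tensorId (Fin (d + 1)) (kingGOp L a msq K (L ^ K) M ∘ₗ
            (((L ^ K : ℕ) : ℝ) • (pull (fun y : Tor (fine (L ^ K) M) => y + unitVec (fine (L ^ K) M) μ) - LinearMap.id)))))
        (fun y y' => m₀ * ((L : ℝ) ^ K) ^ (-(γ / 2)) * Real.exp (-(δ * tdistT M y y'))) := by
  obtain ⟨m₀, δ, hm₀, hδ, H⟩ := hasMaj_idef_tensorId_kingSOp (d := d) L hLodd hL ha hm0 hγ0 hγ1
  refine ⟨m₀, δ, hm₀, hδ, fun K hK n hn e M _ hM msq hmsq hcap μ => ?_⟩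
  have hK0 : ∀ y y' : Tor M, 0 ≤ m₀ * ((L : ℝ) ^ K) ^ (-(γ / 2)) * Real.exp (-(δ * tdistT M y y')) := fun y y' =>
    mul_nonneg (mul_nonneg hm₀.le (Real.rpow_nonneg (pow_nonneg (Nat.cast_nonneg _) _) _)) (Real.exp_nonneg _)
  have h0 := H K hK n hn e M hM msq hmsq hcap μ
  have h := hasMaj_reflConj (g := unitTorusGeo L K M) (blk₁ := blkFine L K M)
    (blk₂ := fun i : Tor (fine (L ^ n * L ^ K) M) × Fin (d + 1) => blockOf (L ^ n * L ^ K) M i.1)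
    (φ₁ := fun p : Tor (fine (L ^ K) M) × Fin (d + 1) => (torRefl (fine (L ^ K) M) μ p.1, p.2))
    (φ₂ := fun p : Tor (fine (L ^ n * L ^ K) M) × Fin (d + 1) => (torRefl (fine (L ^ n * L ^ K) M) μ p.1, p.2)) (ψ := torRefl M μ)
    (fun y => torRefl_torRefl y) (fun p => blockOf_torRefl (L ^ K) M μ p.1) (fun p => blockOf_torRefl (L ^ n * L ^ K) M μ p.1)
    hK0 (fun y y' => by rw [tdistT_torRefl]) h0
  rw [← idef_reflConj (φ₁' := fun p : Tor (fine (L ^ n * L ^ K) M) × Fin (d + 1) => (torRefl (fine (L ^ n * L ^ K) M) μ p.1, p.2))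
    (φ₂ := fun p : Tor (fine (L ^ K) M) × Fin (d + 1) => (torRefl (fine (L ^ K) M) μ p.1, p.2))
    (fun p => congr_fun (kingPrV_reflC L M μ K n) p) (fun p => congr_fun (kingPrV_reflC L M μ K n) p),
    reflC_comp_tensorId_kingSOp_comp, reflC_comp_tensorId_kingSOp_comp] at h
  exact h

/-! ## §3 ★★ The cell-oscillation row of `S̃_μ ⊗ 1` -/

/-- ★★ **THE CELL-OSCILLATION ROW OF THE FORWARD SOURCE DIFFERENCE, SUP-BLOCK CURRENCY, HYPOTHESIS-FREE**:
`(S̃′_μ ⊗ 1)∘𝔇_{kingPrV}(M_{c′}, M_{blockAvg c′}) ≤ C·r·(L^K)^{−1∕(8(d+1))}·e^{−δ|y−y′|_T}` for `|c′| ≤ r` — FILE 65's ★★ at the reflected letter `c′∘σ_μ` (still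
bounded by `r`), conjugated: `σ_μ` commutes with the pairing and with the block averages (FILE 66 `pull_comp_idef_mulOp`, `blockAvg_comp_refl`).  The located
row of programme Y's by-parts fixed point. [cite: Balaban1985BackgroundPropagators, Thm 3.1 (3.42) p.397 (third entry, the row's consumer), (3.52) p.400 (first-order
species: shape); King1986, (2.13) p.653, (4.1)–(4.5) p.670, p.664 (pairing), Prop. 3.9 (3.73) p.665 (rate factor)] -/
theorem hasMaj_kingSOpFwd_comp_idef_mulOp_blockAvg (hLodd : Odd L) (hL2 : 2 ≤ L) {a : ℝ} (ha : 0 < a) {m0sq : ℝ} (hm0 : 0 ≤ m0sq) :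
    ∃ δ C : ℝ, 0 < δ ∧ 0 < C ∧ ∀ (K : ℕ), 1 ≤ K → ∀ (n e : ℕ) (M : Fin (d + 1) → ℕ) [∀ μ, NeZero (M μ)], (∀ μ, M μ = 2 * L ^ e) →
      ∀ (msq : ℝ), 0 < msq → msq ≤ m0sq → ∀ (μ : Fin (d + 1)) (c' : Tor (fine (L ^ n * L ^ K) M) × Fin (d + 1) → ℝ) (r : ℝ), 0 ≤ r → (∀ z, |c' z| ≤ r) →
      HasMaj (BlockNorm.ofBlocks (unitTorusGeo L K M) (blkFine L K M))
        (BlockNorm.ofBlocks (unitTorusGeo L K M) (fun p : Tor (fine (L ^ n * L ^ K) M) × Fin (d + 1) => blockOf (L ^ n * L ^ K) M p.1))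
        (tensorId (Fin (d + 1)) (kingGOp L a msq (K + n) (L ^ n * L ^ K) M ∘ₗ
            (((L ^ n * L ^ K : ℕ) : ℝ) • (pull (fun y : Tor (fine (L ^ n * L ^ K) M) => y + unitVec (fine (L ^ n * L ^ K) M) μ) - LinearMap.id))) ∘ₗ
          idef (pull (kingPrV L K n M)) (pull (kingPrV L K n M)) (mulOp c') (mulOp (blockAvg (kingPrV L K n M) c')))
        (fun y y' => C * r * ((L ^ K : ℕ) : ℝ) ^ (-(1 / (8 * ((d : ℝ) + 1)))) * Real.exp (-(δ * tdistT M y y'))) := by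
  classical
  obtain ⟨δ, C, hδ, hC, H⟩ := hasMaj_kingSOp_comp_idef_mulOp_blockAvg (d := d) hLodd hL2 ha hm0
  refine ⟨δ, C, hδ, hC, fun K hK n e M _ hM msq hmsq hcap μ c' r hr hc' => ?_⟩
  -- the two coloured reflections and their compatibility with King's pairing
  obtain ⟨σf, hσf⟩ : ∃ σf : Tor (fine (L ^ n * L ^ K) M) × Fin (d + 1) → Tor (fine (L ^ n * L ^ K) M) × Fin (d + 1),
      σf = fun p => (torRefl (fine (L ^ n * L ^ K) M) μ p.1, p.2) := ⟨_, rfl⟩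
  obtain ⟨σc, hσc⟩ : ∃ σc : Tor (fine (L ^ K) M) × Fin (d + 1) → Tor (fine (L ^ K) M) × Fin (d + 1),
      σc = fun p => (torRefl (fine (L ^ K) M) μ p.1, p.2) := ⟨_, rfl⟩
  have hσf2 : Function.Involutive σf := fun p => by rw [hσf]; simp [torRefl_torRefl]
  have hσc2 : Function.Involutive σc := fun p => by rw [hσc]; simp [torRefl_torRefl]
  have hπ : ∀ p, kingPrV L K n M (σf p) = σc (kingPrV L K n M p) := fun p => by
    rw [hσf, hσc]; exact congr_fun (kingPrV_reflC L M μ K n) p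
  have hbf : ∀ p, blockOf (L ^ n * L ^ K) M (σf p).1 = torRefl M μ (blockOf (L ^ n * L ^ K) M p.1) := fun p => by
    rw [hσf]; exact blockOf_torRefl (L ^ n * L ^ K) M μ p.1
  have hbc : ∀ p : Tor (fine (L ^ K) M) × Fin (d + 1), blkFine L K M (σc p) = torRefl M μ (blkFine L K M p) := fun p => by
    rw [hσc]; exact blockOf_torRefl (L ^ K) M μ p.1
  -- FILE 65 at the reflected letter `c′∘σ_f` (still bounded by `r`), conjugated
  have hc'' : ∀ z, |(c' ∘ σf) z| ≤ r := fun z => hc' _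
  have h0 := H K hK n e M hM msq hmsq hcap μ (c' ∘ σf) r hr hc''
  have hK0 : ∀ y y' : Tor M, 0 ≤ C * r * ((L ^ K : ℕ) : ℝ) ^ (-(1 / (8 * ((d : ℝ) + 1)))) * Real.exp (-(δ * tdistT M y y')) := fun y y' =>
    mul_nonneg (mul_nonneg (mul_nonneg hC.le hr) (Real.rpow_nonneg (Nat.cast_nonneg _) _)) (Real.exp_nonneg _)
  have h := hasMaj_reflConj (g := unitTorusGeo L K M) (blk₁ := blkFine L K M)
    (blk₂ := fun i : Tor (fine (L ^ n * L ^ K) M) × Fin (d + 1) => blockOf (L ^ n * L ^ K) M i.1)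
    (φ₁ := σc) (φ₂ := σf) (ψ := torRefl M μ) (fun y => torRefl_torRefl y) hbc hbf hK0 (fun y y' => by rw [tdistT_torRefl]) h0
  -- the conjugated operator IS the target operator: `σ_f∘(S′∘𝔇(c′∘σ_f))∘σ_c = S̃′∘𝔇(c′)`
  have hD : pull σf ∘ₗ idef (pull (kingPrV L K n M)) (pull (kingPrV L K n M)) (mulOp (c' ∘ σf)) (mulOp (blockAvg (kingPrV L K n M) (c' ∘ σf)))
      = idef (pull (kingPrV L K n M)) (pull (kingPrV L K n M)) (mulOp c') (mulOp (blockAvg (kingPrV L K n M) c')) ∘ₗ pull σc := by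
    rw [pull_comp_idef_mulOp hπ, blockAvg_comp_refl hσc2 hσf2 hπ]
    have e1 : (c' ∘ σf) ∘ σf = c' := funext fun p => by simp only [Function.comp_apply, hσf2 p]
    have e2 : (blockAvg (kingPrV L K n M) c' ∘ σc) ∘ σc = blockAvg (kingPrV L K n M) c' := funext fun p => by simp only [Function.comp_apply, hσc2 p]
    rw [e1, e2]
  have hS := reflC_comp_tensorId_kingSOp_comp L μ (L ^ n * L ^ K) M a msq (K + n)
  rw [← hσf] at hS
  have hcc : ∀ g : Tor (fine (L ^ K) M) × Fin (d + 1) → ℝ, pull σc (pull σc g) = g := fun g => funext fun p => by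
    simp only [pull_apply, hσc2 p]
  have hop : pull σf ∘ₗ (tensorId (Fin (d + 1)) (kingSOp L a msq (K + n) (L ^ n * L ^ K) M μ) ∘ₗ
        idef (pull (kingPrV L K n M)) (pull (kingPrV L K n M)) (mulOp (c' ∘ σf)) (mulOp (blockAvg (kingPrV L K n M) (c' ∘ σf)))) ∘ₗ pull σc
      = tensorId (Fin (d + 1)) (kingGOp L a msq (K + n) (L ^ n * L ^ K) M ∘ₗ
            (((L ^ n * L ^ K : ℕ) : ℝ) • (pull (fun y : Tor (fine (L ^ n * L ^ K) M) => y + unitVec (fine (L ^ n * L ^ K) M) μ) - LinearMap.id))) ∘ₗ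
          idef (pull (kingPrV L K n M)) (pull (kingPrV L K n M)) (mulOp c') (mulOp (blockAvg (kingPrV L K n M) c')) := by
    refine LinearMap.ext fun g => ?_
    have e3 : idef (pull (kingPrV L K n M)) (pull (kingPrV L K n M)) (mulOp (c' ∘ σf)) (mulOp (blockAvg (kingPrV L K n M) (c' ∘ σf))) (pull σc g)
        = pull σf (idef (pull (kingPrV L K n M)) (pull (kingPrV L K n M)) (mulOp c') (mulOp (blockAvg (kingPrV L K n M) c')) g) := by
      have h1 := LinearMap.congr_fun hD (pull σc g)
      simp only [LinearMap.comp_apply, hcc] at h1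
      rw [← h1]
      exact (funext fun p => by simp only [pull_apply, hσf2 p]).symm
    have hF1 := LinearMap.congr_fun hS (idef (pull (kingPrV L K n M)) (pull (kingPrV L K n M)) (mulOp c') (mulOp (blockAvg (kingPrV L K n M) c')) g)
    simp only [LinearMap.comp_apply] at hF1 ⊢
    rw [e3, hF1]
  rw [hop] at h
  exact h

end Summit.QuantumFields.YangMills.BalabanUVNodes.N15.KingModel.SrcDiv
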